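import Literature.Geometry.Riemannian.NormalExponentialMap
import Literature.Geometry.Riemannian.ExpMapLocalDiffeo
import Literature.Geometry.Riemannian.ExponentialMapSmooth
import Literature.Geometry.Lorentzian.DataEmbeddingNormalSmooth
import Literature.Geometry.Lorentzian.CauchyDevelopmentOneJet
import Literature.Geometry.Lorentzian.ConvergenceTransport
import Mathlib.Analysis.Calculus.Deriv.MeanValue
import HarnessLib

/-!
# Local acausality of the data hypersurface: short past causal radial geodesics from a point of
# the hypersurface do not return to it (Gaussian normal coordinates; O'Neill 1983, Ch. 14,
# Lemma 14.42 ff.; Hawking–Ellis 1973, §6.5)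

Let `𝒮 = (M, g, τ, ι, ν)` be a data embedding (`Literature.Geometry.Lorentzian.DataEmbedding`):
`ι : X → M` an embedding of the data manifold as a spacelike hypersurface with future unit normal
`ν`. **At every point `s = ι x₀` there is `r₀ > 0` such that for every past causal `w ∈ T_sM`,
`0 < ‖w‖ < r₀`, the point `exp_s(w)` is not on `ι(X)`**
(`DataEmbedding.exists_expMap_pastCausal_not_mem_range`). In Gaussian normal coordinates
`(x, t) ↦ exp_{ι x}(t ν x)` about `s` — a local diffeomorphism by the tubular-neighbourhood
computation `dE_{(x,0)}(w, a) = dι w + a ν` (`isLocalDiffeomorphAt_normalExp_zero`,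
`Literature/Geometry/Riemannian/NormalExponentialMap.lean`) — the normal coordinate `f = t` is a
local defining function of `ι(X)` with `df_s(u) = -g(ν, u)`, negative on past causal `u`; so the
radial functions `r ↦ f(exp_s(r w))`, `w` past causal of norm one, have negative derivative at
`r = 0`, uniformly on the compact set of such `w` and hence on a uniform interval `[0, r₀)`
(`IsCompact.eventually_forall_of_forall_eventually`): `f(exp_s(w)) < 0 = f|ι(X)`. This is the
local ingredient ("a spacelike hypersurface is locally acausal") of the causal theory of the
domain of dependence (Hawking–Ellis 1973, §6.5; O'Neill 1983, Ch. 14, Lemmas 14.42–14.45).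

Everything is proved; no definitions and no named facts are introduced (D-0026).

## References

* B. O'Neill, *Semi-Riemannian geometry with applications to relativity*, 1983, Ch. 14,
  Lemmas 14.42–14.45; Ch. 5, Lemma 5.26 ff. [ONeillSemiRiemannian1983]
* S. W. Hawking, G. F. R. Ellis, *The large scale structure of space-time*, CUP 1973, §6.5.
* J. M. Lee, *Introduction to Riemannian Manifolds*, 2nd ed. (2018), Thm. 5.25 (normal
  exponential map). [LeeRiemannianManifolds2018]
-/

noncomputable section

open Bundle Set Filter Function
open scoped Manifold ContDiff Topology

namespace Literature.Geometry.Lorentzian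

open Literature.Geometry.Riemannian

universe u

variable {n : ℕ} {X : Type u} [TopologicalSpace X] [ChartedSpace (EuclideanSpace ℝ (Fin n)) X]
  [IsManifold (𝓡 n) ∞ X] [ConnectedSpace X] {D : InitialDataSet (𝓡 n) X}

namespace DataEmbedding

/-- **Short past causal radial geodesics from a point of the data hypersurface leave it**: for
`s = ι x₀` there is `r₀ > 0` such that `exp_s(w) ∉ ι(X)` for every past-directed causal
`w ∈ T_sM` with `‖w‖ < r₀` (such `w` lie in the domain of `exp_s`). See the module docstring
(Gaussian normal coordinates, the normal coordinate as a local defining function with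
`df_s = -g(ν, ·)`, uniform negativity of the radial derivatives on the compact set of unit past
causal directions). [cite: ONeillSemiRiemannian1983, Ch. 14, Lemma 14.42 ff.; Ch. 5, Lemma 5.26 ff.] -/
theorem exists_expMap_pastCausal_not_mem_range (𝒮 : DataEmbedding D) [𝒮.metric.HasLeviCivita]
    (x₀ : X) :
    ∃ r₀ > 0, ∀ w : EuclideanSpace ℝ (Fin (n + 1)),
      𝒮.timeOrientation.IsPastDirected (x := 𝒮.embed x₀) w → ‖w‖ < r₀ →
      (show TangentSpace (𝓡 (n + 1)) (𝒮.embed x₀) from w) ∈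
          expDomain 𝒮.metric.leviCivita (𝒮.embed x₀) ∧
        expMap 𝒮.metric.leviCivita (𝒮.embed x₀)
          (show TangentSpace (𝓡 (n + 1)) (𝒮.embed x₀) from w) ∉ range 𝒮.embed := by
  -- regularity instances of the smooth spacetime metric
  haveI h1 : CovariantDerivative.ContMDiffCovariantDerivative 𝒮.metric.leviCivita 1 :=
    ⟨𝒮.metric.isLocallyContMDiff_leviCivita_holds 1 (by exact_mod_cast le_top) univ isOpen_univ⟩
  haveI hinf : CovariantDerivative.ContMDiffCovariantDerivative 𝒮.metric.leviCivita ∞ :=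
    contMDiffCovariantDerivative_leviCivita_infty 𝒮.metric.toPseudoRiemannianMetric le_rfl
  set cov := 𝒮.metric.leviCivita with hcov
  letI : NormedAddCommGroup (TangentSpace (𝓡 (n + 1)) (𝒮.embed x₀)) :=
    inferInstanceAs (NormedAddCommGroup (EuclideanSpace ℝ (Fin (n + 1))))
  letI : NormedSpace ℝ (TangentSpace (𝓡 (n + 1)) (𝒮.embed x₀)) :=
    inferInstanceAs (NormedSpace ℝ (EuclideanSpace ℝ (Fin (n + 1))))
  /- (1) Gaussian normal coordinates: the normal exponential map `E(x, t) = exp_{ι x}(t ν x)` is a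
    local diffeomorphism at `(x₀, 0)` -/
  have hνs : ContMDiff (𝓡 n) (𝓡 (n + 1)).tangent ∞
      (fun x ↦ (TotalSpace.mk' (EuclideanSpace ℝ (Fin (n + 1))) (𝒮.embed x) (𝒮.normal x) :
        TangentBundle (𝓡 (n + 1)) 𝒮.carrier)) := fun x ↦ 𝒮.contMDiffAt_embed_normal x
  have hιinj : Injective (mfderiv (𝓡 n) (𝓡 (n + 1)) 𝒮.embed x₀) := 𝒮.mfderiv_embed_injective x₀
  have hνz : 𝒮.normal x₀ ∉ range (mfderiv (𝓡 n) (𝓡 (n + 1)) 𝒮.embed x₀) :=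
    not_mem_range_of_normal (F := EuclideanSpace ℝ (Fin (n + 1))) (F' := EuclideanSpace ℝ (Fin n))
      (A := mfderiv (𝓡 n) (𝓡 (n + 1)) 𝒮.embed x₀) (𝒮.metric.val (𝒮.embed x₀))
      (ne_of_eq_of_ne (𝒮.isFutureUnitNormal.1.2 x₀) (by norm_num))
      (fun w ↦ 𝒮.isFutureUnitNormal.1.1 x₀ w)
  have hdim : Module.finrank ℝ (EuclideanSpace ℝ (Fin n)) + 1 =
      Module.finrank ℝ (EuclideanSpace ℝ (Fin (n + 1))) := by simp
  obtain ⟨Φ, hΦ0, hΦeq⟩ := isLocalDiffeomorphAt_normalExp_zero (cov := cov) (k := (⊤ : ℕ∞))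
    (I := 𝓡 (n + 1)) (I' := 𝓡 n) le_top hνs hιinj hνz hdim
  set nE : X × ℝ → 𝒮.carrier := fun q ↦ expMap cov (𝒮.embed q.1) (q.2 • 𝒮.normal q.1) with hnE
  have hnE0 : ∀ x, nE (x, 0) = 𝒮.embed x := fun x ↦ normalExp_zero (cov := cov) x
  have hΦs : Φ (x₀, 0) = (𝒮.embed x₀) := by rw [← hΦeq hΦ0]; exact hnE0 x₀
  have hst : (𝒮.embed x₀) ∈ Φ.target := by rw [← hΦs]; exact Φ.map_source hΦ0
  /- (2) the normal coordinate `f = t ∘ Φ⁻¹`, a local defining function of `ι(X)` -/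
  set f : 𝒮.carrier → ℝ := fun q ↦ (Φ.toPartialEquiv.symm q).2 with hf
  have hfs : ContMDiffOn (𝓡 (n + 1)) 𝓘(ℝ, ℝ) ∞ f Φ.target :=
    contMDiff_snd.comp_contMDiffOn Φ.contMDiffOn_invFun
  have hfd : MDifferentiableAt (𝓡 (n + 1)) 𝓘(ℝ, ℝ) f (𝒮.embed x₀) :=
    (hfs.contMDiffAt (Φ.open_target.mem_nhds hst)).mdifferentiableAt (by simp)
  have hf0 : ∀ x, (x, (0 : ℝ)) ∈ Φ.source → f (𝒮.embed x) = 0 := by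
    intro x hx
    have h1 : 𝒮.embed x = Φ (x, 0) := by rw [← hΦeq hx]; exact (hnE0 x).symm
    show (Φ.toPartialEquiv.symm (𝒮.embed x)).2 = 0
    rw [h1, Φ.toPartialEquiv.left_inv hx]
  have hfs0 : f (𝒮.embed x₀) = 0 := hf0 x₀ hΦ0
  -- points of `ι(X)` near `(𝒮.embed x₀)` are `ι x` with `(x, 0) ∈ Φ.source`
  obtain ⟨U₁, hU₁o, hU₁⟩ : ∃ U₁ : Set 𝒮.carrier, IsOpen U₁ ∧
      𝒮.embed ⁻¹' U₁ = {x | (x, (0 : ℝ)) ∈ Φ.source} := by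
    have hO : IsOpen {x : X | (x, (0 : ℝ)) ∈ Φ.source} :=
      Φ.open_source.preimage (Continuous.prodMk_left 0)
    obtain ⟨U₁, hU₁o, hU₁⟩ := 𝒮.isSmoothEmbedding.isEmbedding.isInducing.isOpen_iff.1 hO
    exact ⟨U₁, hU₁o, hU₁⟩
  have hsU₁ : (𝒮.embed x₀) ∈ U₁ := by
    have : x₀ ∈ 𝒮.embed ⁻¹' U₁ := by rw [hU₁]; exact hΦ0
    exact this
  /- (3) the differential of `f` at `(𝒮.embed x₀)`: `df_s(u) = -𝒮.metric(ν, u)` -/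
  have hkey : ∀ u : TangentSpace (𝓡 (n + 1)) (𝒮.embed x₀),
      mfderiv (𝓡 (n + 1)) 𝓘(ℝ, ℝ) f (𝒮.embed x₀) u = -(𝒮.metric.val (𝒮.embed x₀) (𝒮.normal x₀) u) := by
    -- `f ∘ Φ = snd` near `(x₀, 0)`, so `df_s ∘ dΦ = snd`
    have hΦd : MDifferentiableAt ((𝓡 n).prod 𝓘(ℝ, ℝ)) (𝓡 (n + 1)) Φ (x₀, 0) :=
      (Φ.contMDiffOn_toFun.contMDiffAt (Φ.open_source.mem_nhds hΦ0)).mdifferentiableAt (by simp)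
    have hcomp : mfderiv ((𝓡 n).prod 𝓘(ℝ, ℝ)) 𝓘(ℝ, ℝ) (f ∘ Φ) (x₀, 0) =
        (mfderiv (𝓡 (n + 1)) 𝓘(ℝ, ℝ) f (𝒮.embed x₀)).comp (mfderiv ((𝓡 n).prod 𝓘(ℝ, ℝ)) (𝓡 (n + 1)) Φ (x₀, 0)) := by
      rw [← hΦs] at hfd
      rw [mfderiv_comp (x₀, 0) hfd hΦd, hΦs]
    have hsnd : mfderiv ((𝓡 n).prod 𝓘(ℝ, ℝ)) 𝓘(ℝ, ℝ) (f ∘ Φ) (x₀, 0) =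
        mfderiv ((𝓡 n).prod 𝓘(ℝ, ℝ)) 𝓘(ℝ, ℝ) (Prod.snd : X × ℝ → ℝ) (x₀, 0) := by
      refine Filter.EventuallyEq.mfderiv_eq ?_
      filter_upwards [Φ.open_source.mem_nhds hΦ0] with q hq
      show (Φ.toPartialEquiv.symm (Φ q)).2 = q.2
      rw [Φ.toPartialEquiv.left_inv hq]
    have hdΦ : ∀ q : TangentSpace ((𝓡 n).prod 𝓘(ℝ, ℝ)) (x₀, (0 : ℝ)),
        mfderiv ((𝓡 n).prod 𝓘(ℝ, ℝ)) (𝓡 (n + 1)) Φ (x₀, 0) q =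
          mfderiv (𝓡 n) (𝓡 (n + 1)) 𝒮.embed x₀ q.1 + q.2 • 𝒮.normal x₀ := by
      intro q
      have heq : mfderiv ((𝓡 n).prod 𝓘(ℝ, ℝ)) (𝓡 (n + 1)) Φ (x₀, 0) =
          mfderiv ((𝓡 n).prod 𝓘(ℝ, ℝ)) (𝓡 (n + 1)) nE (x₀, 0) := by
        refine Filter.EventuallyEq.mfderiv_eq ?_
        filter_upwards [Φ.open_source.mem_nhds hΦ0] with q hq
        exact (hΦeq hq).symm
      rw [heq]
      exact mfderiv_normalExp_zero_apply (cov := cov) (k := (⊤ : ℕ∞)) le_top hνs x₀ q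
    have hval : ∀ q : TangentSpace ((𝓡 n).prod 𝓘(ℝ, ℝ)) (x₀, (0 : ℝ)),
        mfderiv (𝓡 (n + 1)) 𝓘(ℝ, ℝ) f (𝒮.embed x₀)
          (mfderiv (𝓡 n) (𝓡 (n + 1)) 𝒮.embed x₀ q.1 + q.2 • 𝒮.normal x₀) = q.2 := by
      intro q
      have e1 : mfderiv ((𝓡 n).prod 𝓘(ℝ, ℝ)) 𝓘(ℝ, ℝ) (f ∘ Φ) (x₀, 0) q =
          mfderiv (𝓡 (n + 1)) 𝓘(ℝ, ℝ) f (𝒮.embed x₀)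
            (mfderiv ((𝓡 n).prod 𝓘(ℝ, ℝ)) (𝓡 (n + 1)) Φ (x₀, 0) q) := by
        rw [hcomp]; rfl
      rw [hdΦ q, hsnd, mfderiv_snd] at e1
      exact e1.symm
    -- every `u` is `dι w + a ν`
    obtain ⟨L, hL⟩ := exists_continuousLinearEquiv_coprod_toSpanSingleton
      (F := EuclideanSpace ℝ (Fin (n + 1))) (F' := EuclideanSpace ℝ (Fin n))
      (A := mfderiv (𝓡 n) (𝓡 (n + 1)) 𝒮.embed x₀) (v := 𝒮.normal x₀) hιinj hνz hdim
    intro u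
    set q : EuclideanSpace ℝ (Fin n) × ℝ := L.symm u with hq
    have hu : u = mfderiv (𝓡 n) (𝓡 (n + 1)) 𝒮.embed x₀ q.1 + q.2 • 𝒮.normal x₀ := by
      have h1 : (L : EuclideanSpace ℝ (Fin n) × ℝ →L[ℝ] EuclideanSpace ℝ (Fin (n + 1))) q = u :=
        L.apply_symm_apply u
      rw [hL] at h1
      rw [← h1]
      rfl
    rw [hu, hval q, map_add, map_smul, 𝒮.isFutureUnitNormal.1.1 x₀ q.1,
      𝒮.isFutureUnitNormal.1.2 x₀]
    simp
  /- (4) the radial functions `F(r, w) = f(exp_s(r w))` -/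
  obtain ⟨S, hSo, hS0, hSdom, hexps⟩ := exists_isOpen_contMDiffOn_expMap_at (cov := cov) (𝒮.embed x₀)
  set ex : EuclideanSpace ℝ (Fin (n + 1)) → 𝒮.carrier :=
    fun v ↦ expMap cov (𝒮.embed x₀) (show TangentSpace (𝓡 (n + 1)) (𝒮.embed x₀) from v) with hex
  set sm : ℝ × EuclideanSpace ℝ (Fin (n + 1)) → EuclideanSpace ℝ (Fin (n + 1)) :=
    fun p ↦ p.1 • p.2 with hsm
  set A : Set (ℝ × EuclideanSpace ℝ (Fin (n + 1))) :=
    {p | sm p ∈ S ∧ ex (sm p) ∈ Φ.target ∧ ex (sm p) ∈ U₁} with hA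
  have hsmc : Continuous sm := continuous_fst.smul continuous_snd
  have hexc : ContinuousOn ex S := hexps.continuousOn
  have hAo : IsOpen A := by
    have h1 : IsOpen (sm ⁻¹' S) := hSo.preimage hsmc
    have h2 : IsOpen ((sm ⁻¹' S) ∩ (ex ∘ sm) ⁻¹' (Φ.target ∩ U₁)) :=
      (hexc.comp hsmc.continuousOn (fun p hp ↦ hp)).isOpen_inter_preimage h1
        (Φ.open_target.inter hU₁o)
    have heq : A = (sm ⁻¹' S) ∩ (ex ∘ sm) ⁻¹' (Φ.target ∩ U₁) := by
      ext p
      simp only [hA, mem_setOf_eq, mem_inter_iff, mem_preimage, comp_apply]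
    rw [heq]; exact h2
  have hex0 : ex 0 = (𝒮.embed x₀) := expMap_zero (cov := cov) (𝒮.embed x₀)
  have hA0 : ∀ w, ((0 : ℝ), w) ∈ A := fun w ↦ by
    have h0 : sm (0, w) = 0 := zero_smul ℝ w
    have h1 : ex (sm (0, w)) = 𝒮.embed x₀ := by rw [h0, hex0]
    refine ⟨?_, ?_, ?_⟩
    · rw [h0]; exact hS0
    · rw [h1]; exact hst
    · rw [h1]; exact hsU₁
  set F : ℝ × EuclideanSpace ℝ (Fin (n + 1)) → ℝ := fun p ↦ f (ex (sm p)) with hF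
  have hFs : ContDiffOn ℝ ∞ F A := by
    rw [← contMDiffOn_iff_contDiffOn]
    have h1 : ContMDiffOn 𝓘(ℝ, ℝ × EuclideanSpace ℝ (Fin (n + 1))) 𝓘(ℝ, EuclideanSpace ℝ (Fin (n + 1)))
        ∞ sm A := by
      rw [contMDiffOn_iff_contDiffOn]
      exact (contDiff_fst.smul contDiff_snd).contDiffOn
    have h2 : ContMDiffOn 𝓘(ℝ, ℝ × EuclideanSpace ℝ (Fin (n + 1))) (𝓡 (n + 1)) ∞ (ex ∘ sm) A :=
      hexps.comp h1 fun p hp ↦ hp.1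
    exact hfs.comp h2 fun p hp ↦ hp.2.1
  have hF0 : ∀ w, F (0, w) = 0 := fun w ↦ by
    show f (ex (sm (0, w))) = 0
    rw [show sm (0, w) = 0 from zero_smul ℝ w, hex0]
    exact hfs0
  -- the `r`-derivative of `F`
  set F₁ : ℝ × EuclideanSpace ℝ (Fin (n + 1)) → ℝ := fun p ↦ fderiv ℝ F p (1, 0) with hF₁
  have hF₁c : ContinuousOn F₁ A :=
    (hFs.continuousOn_fderiv_of_isOpen hAo (by simp)).clm_apply
      (continuousOn_const (c := ((1 : ℝ), (0 : EuclideanSpace ℝ (Fin (n + 1))))))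
  have hFd : ∀ p ∈ A, HasFDerivAt F (fderiv ℝ F p) p := fun p hp ↦
    ((hFs.contDiffAt (hAo.mem_nhds hp)).differentiableAt (by simp)).hasFDerivAt
  -- partial derivative in `r` as a one-variable derivative
  have hFr : ∀ p ∈ A, HasDerivAt (fun r ↦ F (r, p.2)) (F₁ p) p.1 := by
    rintro ⟨r, w⟩ hp
    have hincl : HasFDerivAt (fun ρ : ℝ ↦ (ρ, w)) (ContinuousLinearMap.inl ℝ ℝ _) r :=
      (hasFDerivAt_id r).prodMk (hasFDerivAt_const w r)
    have h := (hFd (r, w) hp).comp r hincl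
    have h' : HasDerivAt (fun ρ : ℝ ↦ F (ρ, w)) ((fderiv ℝ F (r, w)).comp
        (ContinuousLinearMap.inl ℝ ℝ _) 1) r := h.hasDerivAt
    simpa [hF₁] using h'
  /- (5) at `r = 0`: `F₁(0, w) = df_s(w) = -𝒮.metric(ν, w)` -/
  have hF₁0 : ∀ w : EuclideanSpace ℝ (Fin (n + 1)),
      F₁ (0, w) = -(𝒮.metric.val (𝒮.embed x₀) (𝒮.normal x₀) (show TangentSpace (𝓡 (n + 1)) (𝒮.embed x₀) from w)) := by
    intro w
    -- the curve `r ↦ F(r, w) = (f ∘ ex)(r • w)` has derivative `d(f ∘ ex)_0 (w)` at `0`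
    have hexd : MDifferentiableAt 𝓘(ℝ, EuclideanSpace ℝ (Fin (n + 1))) (𝓡 (n + 1)) ex 0 :=
      (contMDiffAt_expMap_zero (cov := cov) (𝒮.embed x₀)).mdifferentiableAt (by simp)
    have hfd' : MDifferentiableAt (𝓡 (n + 1)) 𝓘(ℝ, ℝ) f (ex 0) := by rw [hex0]; exact hfd
    have hfe : MDifferentiableAt 𝓘(ℝ, EuclideanSpace ℝ (Fin (n + 1))) 𝓘(ℝ, ℝ) (f ∘ ex) 0 :=
      hfd'.comp 0 hexd
    have hfe' : DifferentiableAt ℝ (f ∘ ex) 0 := mdifferentiableAt_iff_differentiableAt.1 hfe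
    have hmf : mfderiv 𝓘(ℝ, EuclideanSpace ℝ (Fin (n + 1))) 𝓘(ℝ, ℝ) (f ∘ ex) 0 w =
        -(𝒮.metric.val (𝒮.embed x₀) (𝒮.normal x₀) (show TangentSpace (𝓡 (n + 1)) (𝒮.embed x₀) from w)) := by
      rw [mfderiv_comp 0 hfd' hexd]
      show mfderiv (𝓡 (n + 1)) 𝓘(ℝ, ℝ) f (ex 0) (mfderiv 𝓘(ℝ, EuclideanSpace ℝ (Fin (n + 1)))
        (𝓡 (n + 1)) ex 0 w) = _
      rw [mfderiv_expMap_zero (cov := cov) (𝒮.embed x₀)]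
      show mfderiv (𝓡 (n + 1)) 𝓘(ℝ, ℝ) f (ex 0) (show TangentSpace (𝓡 (n + 1)) (ex 0) from w) = _
      rw [hex0]
      exact hkey _
    have hfe_fd : fderiv ℝ (f ∘ ex) 0 w =
        -(𝒮.metric.val (𝒮.embed x₀) (𝒮.normal x₀) (show TangentSpace (𝓡 (n + 1)) (𝒮.embed x₀) from w)) := by
      rw [← mfderiv_eq_fderiv]; exact hmf
    -- chain rule with `r ↦ r • w`
    have hline : HasDerivAt (fun r : ℝ ↦ r • w) w 0 := by
      simpa using (hasDerivAt_id (0 : ℝ)).smul_const w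
    have hcurve : HasDerivAt ((f ∘ ex) ∘ fun r : ℝ ↦ r • w) (fderiv ℝ (f ∘ ex) 0 w) 0 := by
      have h0w : (fun r : ℝ ↦ r • w) 0 = 0 := by simp
      have h' : HasFDerivAt (f ∘ ex) (fderiv ℝ (f ∘ ex) 0) ((fun r : ℝ ↦ r • w) 0) := by
        rw [h0w]; exact hfe'.hasFDerivAt
      exact h'.comp_hasDerivAt 0 hline
    have hcurve' : HasDerivAt (fun r : ℝ ↦ F (r, w)) (F₁ (0, w)) 0 := by
      have h := hFr (0, w) (hA0 w)
      exact h
    have huniq := hcurve'.unique hcurve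
    rw [huniq, hfe_fd]
  /- (6) uniform negativity on the compact set of unit past causal directions -/
  set K : Set (EuclideanSpace ℝ (Fin (n + 1))) :=
    {w | ‖w‖ = 1 ∧ 𝒮.metric.val (𝒮.embed x₀) (show TangentSpace (𝓡 (n + 1)) (𝒮.embed x₀) from w)
      (show TangentSpace (𝓡 (n + 1)) (𝒮.embed x₀) from w) ≤ 0 ∧
      0 ≤ 𝒮.metric.val (𝒮.embed x₀) (𝒮.timeOrientation.vectorField (𝒮.embed x₀)) (show TangentSpace (𝓡 (n + 1)) (𝒮.embed x₀) from w)} with hK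
  have hKc : IsCompact K := by
    have hQ₁ : Continuous fun w : TangentSpace (𝓡 (n + 1)) (𝒮.embed x₀) ↦ 𝒮.metric.val (𝒮.embed x₀) w w :=
      (𝒮.metric.val (𝒮.embed x₀)).continuous₂.comp (continuous_id.prodMk continuous_id)
    have hQ₂ : Continuous fun w : TangentSpace (𝓡 (n + 1)) (𝒮.embed x₀) ↦ 𝒮.metric.val (𝒮.embed x₀) (𝒮.timeOrientation.vectorField (𝒮.embed x₀)) w :=
      (𝒮.metric.val (𝒮.embed x₀) (𝒮.timeOrientation.vectorField (𝒮.embed x₀))).continuous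
    have hcl : IsClosed K := by
      refine (isClosed_eq continuous_norm continuous_const).inter
        ((isClosed_le hQ₁ continuous_const).inter (isClosed_le continuous_const hQ₂))
    have hsub : K ⊆ Metric.closedBall (0 : EuclideanSpace ℝ (Fin (n + 1))) 1 := fun w hw ↦ by
      rw [Metric.mem_closedBall, dist_zero_right, hw.1]
    exact (isCompact_closedBall _ _).of_isClosed_subset hcl hsub
  have hKneg : ∀ w ∈ K, F₁ (0, w) < 0 := by
    rintro w ⟨hw1, hwc, hwT⟩
    rw [hF₁0]
    -- `w` is past causal and nonzero, so `-w` is future-directed and `𝒮.metric(ν, -w) < 0`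
    have hw0 : (show TangentSpace (𝓡 (n + 1)) (𝒮.embed x₀) from w) ≠ 0 := by
      intro h
      have : ‖w‖ = 0 := by rw [show w = 0 from h]; simp
      rw [hw1] at this; exact one_ne_zero this
    have hcausal : 𝒮.metric.IsCausal (show TangentSpace (𝓡 (n + 1)) (𝒮.embed x₀) from w) := ⟨hwc, hw0⟩
    have hpast : 𝒮.timeOrientation.IsPastDirected (show TangentSpace (𝓡 (n + 1)) (𝒮.embed x₀) from w) := by
      rcases 𝒮.timeOrientation.isFutureDirected_or_isPastDirected_of_isCausal hcausal with h | h
      · exact absurd h.2 (not_lt.2 hwT)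
      · exact h
    have hneg : 𝒮.timeOrientation.IsFutureDirected (-(show TangentSpace (𝓡 (n + 1)) (𝒮.embed x₀) from w)) :=
      (TimeOrientation.isFutureDirected_neg_iff _ _).2 hpast
    have hν := 𝒮.isFutureUnitNormal.2 x₀
    have hνt : 𝒮.metric.IsTimelike (𝒮.normal x₀) := by
      rw [LorentzianMetric.isTimelike_iff, 𝒮.isFutureUnitNormal.1.2 x₀]; norm_num
    have h := TimeOrientation.IsFutureDirected.val_lt_zero 𝒮.timeOrientation hν hνt hneg
    rw [map_neg] at h
    linarith
  -- `F₁ < 0` on `[−r₀, r₀] × K`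
  obtain ⟨r₀, hr₀, hr₀A⟩ : ∃ r₀ > 0, ∀ r : ℝ, |r| < r₀ → ∀ w ∈ K, (r, w) ∈ A ∧ F₁ (r, w) < 0 := by
    have hP : ∀ w ∈ K, ∀ᶠ z : ℝ × EuclideanSpace ℝ (Fin (n + 1)) in 𝓝 ((0 : ℝ), w),
        (z.1, z.2) ∈ A ∧ F₁ (z.1, z.2) < 0 := by
      intro w hw
      have hA' : A ∈ 𝓝 ((0 : ℝ), w) := hAo.mem_nhds (hA0 w)
      have hc : ContinuousAt F₁ (0, w) := hF₁c.continuousAt hA'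
      have hlt : ∀ᶠ z in 𝓝 ((0 : ℝ), w), F₁ z < 0 := hc.eventually_lt continuousAt_const (hKneg w hw)
      filter_upwards [hA', hlt] with z hz hz'
      exact ⟨hz, hz'⟩
    have hev := hKc.eventually_forall_of_forall_eventually
      (P := fun r w ↦ (r, w) ∈ A ∧ F₁ (r, w) < 0) hP
    obtain ⟨r₀, hr₀, h⟩ := Metric.eventually_nhds_iff.1 hev
    refine ⟨r₀, hr₀, fun r hr w hw ↦ h ?_ w hw⟩
    rw [Real.dist_eq, sub_zero]; exact hr
  /- (7) `F(r, w) < 0` for `0 < r < r₀`, `w ∈ K` -/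
  have hFneg : ∀ w ∈ K, ∀ r, 0 < r → r < r₀ → F (r, w) < 0 := by
    intro w hw r hr hrr
    have hanti : StrictAntiOn (fun ρ ↦ F (ρ, w)) (Icc 0 r) := by
      refine strictAntiOn_of_deriv_neg (convex_Icc 0 r) ?_ ?_
      · intro ρ hρ
        have hρA : (ρ, w) ∈ A := (hr₀A ρ (by rw [abs_lt]; constructor <;> linarith [hρ.1, hρ.2]) w hw).1
        exact (hFr (ρ, w) hρA).continuousAt.continuousWithinAt
      · intro ρ hρ
        rw [interior_Icc] at hρ
        have h := hr₀A ρ (by rw [abs_lt]; constructor <;> linarith [hρ.1, hρ.2]) w hw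
        rw [(hFr (ρ, w) h.1).deriv]
        exact h.2
    have h : F (r, w) < F (0, w) := hanti (left_mem_Icc.2 hr.le) (right_mem_Icc.2 hr.le) hr
    rw [hF0 w] at h
    exact h
  /- (8) conclusion -/
  refine ⟨r₀, hr₀, fun w hw hwr ↦ ?_⟩
  have hw0 : w ≠ 0 := fun h ↦ hw.1.2 h
  set r : ℝ := ‖w‖ with hr
  have hrpos : 0 < r := norm_pos_iff.2 hw0
  set u : EuclideanSpace ℝ (Fin (n + 1)) := r⁻¹ • w with hu
  have hru : r • u = w := by
    rw [hu, smul_smul, mul_inv_cancel₀ hrpos.ne', one_smul]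
  have huK : u ∈ K := by
    refine ⟨by rw [hu, norm_smul, norm_inv, norm_norm, inv_mul_cancel₀ hrpos.ne'], ?_, ?_⟩
    · show 𝒮.metric.val (𝒮.embed x₀) (show TangentSpace (𝓡 (n + 1)) (𝒮.embed x₀) from r⁻¹ • w)
        (show TangentSpace (𝓡 (n + 1)) (𝒮.embed x₀) from r⁻¹ • w) ≤ 0
      have h : 𝒮.metric.val (𝒮.embed x₀) (show TangentSpace (𝓡 (n + 1)) (𝒮.embed x₀) from r⁻¹ • w)
          (show TangentSpace (𝓡 (n + 1)) (𝒮.embed x₀) from r⁻¹ • w) =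
          r⁻¹ * (r⁻¹ * 𝒮.metric.val (𝒮.embed x₀) (show TangentSpace (𝓡 (n + 1)) (𝒮.embed x₀) from w)
            (show TangentSpace (𝓡 (n + 1)) (𝒮.embed x₀) from w)) := by
        show 𝒮.metric.val (𝒮.embed x₀) (r⁻¹ • (show TangentSpace (𝓡 (n + 1)) (𝒮.embed x₀) from w))
          (r⁻¹ • (show TangentSpace (𝓡 (n + 1)) (𝒮.embed x₀) from w)) = _
        rw [map_smul, map_smul]
        rfl
      rw [h]
      have hi : 0 < r⁻¹ := inv_pos.2 hrpos
      have hc : 𝒮.metric.val (𝒮.embed x₀) (show TangentSpace (𝓡 (n + 1)) (𝒮.embed x₀) from w)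
          (show TangentSpace (𝓡 (n + 1)) (𝒮.embed x₀) from w) ≤ 0 := hw.1.1
      nlinarith [mul_pos hi hi]
    · show 0 ≤ 𝒮.metric.val (𝒮.embed x₀) (𝒮.timeOrientation.vectorField (𝒮.embed x₀)) (show TangentSpace (𝓡 (n + 1)) (𝒮.embed x₀) from r⁻¹ • w)
      have h : 𝒮.metric.val (𝒮.embed x₀) (𝒮.timeOrientation.vectorField (𝒮.embed x₀)) (show TangentSpace (𝓡 (n + 1)) (𝒮.embed x₀) from r⁻¹ • w) =
          r⁻¹ * 𝒮.metric.val (𝒮.embed x₀) (𝒮.timeOrientation.vectorField (𝒮.embed x₀)) (show TangentSpace (𝓡 (n + 1)) (𝒮.embed x₀) from w) := by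
        show 𝒮.metric.val (𝒮.embed x₀) (𝒮.timeOrientation.vectorField (𝒮.embed x₀)) (r⁻¹ • (show TangentSpace (𝓡 (n + 1)) (𝒮.embed x₀) from w)) = _
        rw [map_smul]
        rfl
      rw [h]
      exact mul_nonneg (inv_pos.2 hrpos).le hw.2.le
  have hA' := (hr₀A r (by rw [abs_of_pos hrpos]; exact hwr) u huK).1
  have hneg := hFneg u huK r hrpos hwr
  have hsmru : sm (r, u) = w := hru
  refine ⟨?_, ?_⟩
  · have h := hSdom _ hA'.1
    rw [hsmru] at h
    exact h
  · rintro ⟨x, hx⟩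
    -- `exp_s w = ι x ∈ U₁`, so `(x, 0) ∈ Φ.source` and `f (ι x) = 0`; but `f (exp_s w) < 0`
    have hwU : ex w ∈ U₁ := by
      have h := hA'.2.2; rwa [hsmru] at h
    have hxU : x ∈ 𝒮.embed ⁻¹' U₁ := by
      show 𝒮.embed x ∈ U₁
      rw [hx]; exact hwU
    rw [hU₁] at hxU
    have h0 : f (𝒮.embed x) = 0 := hf0 x hxU
    have hFw : F (r, u) = f (ex w) := by
      show f (ex (sm (r, u))) = _
      rw [hsmru]
    have : f (ex w) = 0 := by
      have : ex w = 𝒮.embed x := hx.symm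
      rw [this, h0]
    rw [← hFw] at this
    linarith

/-- **Short future causal radial geodesics from a point of the data hypersurface leave it** (time
dual of `exists_expMap_pastCausal_not_mem_range`, same Gaussian-coordinate proof with the
normal coordinate now INCREASING along the radial functions): for `s = ι x₀` there is `r₀ > 0`
such that `exp_s(w) ∉ ι(X)` for every future-directed causal `w ∈ T_sM` with `‖w‖ < r₀`. See the module docstring
(Gaussian normal coordinates, the normal coordinate as a local defining function with
`df_s = -g(ν, ·)`, uniform negativity of the radial derivatives on the compact set of unit past
causal directions). [cite: ONeillSemiRiemannian1983, Ch. 14, Lemma 14.42 ff.; Ch. 5, Lemma 5.26 ff.] -/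
theorem exists_expMap_futureCausal_not_mem_range (𝒮 : DataEmbedding D) [𝒮.metric.HasLeviCivita]
    (x₀ : X) :
    ∃ r₀ > 0, ∀ w : EuclideanSpace ℝ (Fin (n + 1)),
      𝒮.timeOrientation.IsFutureDirected (x := 𝒮.embed x₀) w → ‖w‖ < r₀ →
      (show TangentSpace (𝓡 (n + 1)) (𝒮.embed x₀) from w) ∈
          expDomain 𝒮.metric.leviCivita (𝒮.embed x₀) ∧
        expMap 𝒮.metric.leviCivita (𝒮.embed x₀)
          (show TangentSpace (𝓡 (n + 1)) (𝒮.embed x₀) from w) ∉ range 𝒮.embed := by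
  -- regularity instances of the smooth spacetime metric
  haveI h1 : CovariantDerivative.ContMDiffCovariantDerivative 𝒮.metric.leviCivita 1 :=
    ⟨𝒮.metric.isLocallyContMDiff_leviCivita_holds 1 (by exact_mod_cast le_top) univ isOpen_univ⟩
  haveI hinf : CovariantDerivative.ContMDiffCovariantDerivative 𝒮.metric.leviCivita ∞ :=
    contMDiffCovariantDerivative_leviCivita_infty 𝒮.metric.toPseudoRiemannianMetric le_rfl
  set cov := 𝒮.metric.leviCivita with hcov
  letI : NormedAddCommGroup (TangentSpace (𝓡 (n + 1)) (𝒮.embed x₀)) :=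
    inferInstanceAs (NormedAddCommGroup (EuclideanSpace ℝ (Fin (n + 1))))
  letI : NormedSpace ℝ (TangentSpace (𝓡 (n + 1)) (𝒮.embed x₀)) :=
    inferInstanceAs (NormedSpace ℝ (EuclideanSpace ℝ (Fin (n + 1))))
  /- (1) Gaussian normal coordinates: the normal exponential map `E(x, t) = exp_{ι x}(t ν x)` is a
    local diffeomorphism at `(x₀, 0)` -/
  have hνs : ContMDiff (𝓡 n) (𝓡 (n + 1)).tangent ∞
      (fun x ↦ (TotalSpace.mk' (EuclideanSpace ℝ (Fin (n + 1))) (𝒮.embed x) (𝒮.normal x) :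
        TangentBundle (𝓡 (n + 1)) 𝒮.carrier)) := fun x ↦ 𝒮.contMDiffAt_embed_normal x
  have hιinj : Injective (mfderiv (𝓡 n) (𝓡 (n + 1)) 𝒮.embed x₀) := 𝒮.mfderiv_embed_injective x₀
  have hνz : 𝒮.normal x₀ ∉ range (mfderiv (𝓡 n) (𝓡 (n + 1)) 𝒮.embed x₀) :=
    not_mem_range_of_normal (F := EuclideanSpace ℝ (Fin (n + 1))) (F' := EuclideanSpace ℝ (Fin n))
      (A := mfderiv (𝓡 n) (𝓡 (n + 1)) 𝒮.embed x₀) (𝒮.metric.val (𝒮.embed x₀))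
      (ne_of_eq_of_ne (𝒮.isFutureUnitNormal.1.2 x₀) (by norm_num))
      (fun w ↦ 𝒮.isFutureUnitNormal.1.1 x₀ w)
  have hdim : Module.finrank ℝ (EuclideanSpace ℝ (Fin n)) + 1 =
      Module.finrank ℝ (EuclideanSpace ℝ (Fin (n + 1))) := by simp
  obtain ⟨Φ, hΦ0, hΦeq⟩ := isLocalDiffeomorphAt_normalExp_zero (cov := cov) (k := (⊤ : ℕ∞))
    (I := 𝓡 (n + 1)) (I' := 𝓡 n) le_top hνs hιinj hνz hdim
  set nE : X × ℝ → 𝒮.carrier := fun q ↦ expMap cov (𝒮.embed q.1) (q.2 • 𝒮.normal q.1) with hnE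
  have hnE0 : ∀ x, nE (x, 0) = 𝒮.embed x := fun x ↦ normalExp_zero (cov := cov) x
  have hΦs : Φ (x₀, 0) = (𝒮.embed x₀) := by rw [← hΦeq hΦ0]; exact hnE0 x₀
  have hst : (𝒮.embed x₀) ∈ Φ.target := by rw [← hΦs]; exact Φ.map_source hΦ0
  /- (2) the normal coordinate `f = t ∘ Φ⁻¹`, a local defining function of `ι(X)` -/
  set f : 𝒮.carrier → ℝ := fun q ↦ (Φ.toPartialEquiv.symm q).2 with hf
  have hfs : ContMDiffOn (𝓡 (n + 1)) 𝓘(ℝ, ℝ) ∞ f Φ.target :=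
    contMDiff_snd.comp_contMDiffOn Φ.contMDiffOn_invFun
  have hfd : MDifferentiableAt (𝓡 (n + 1)) 𝓘(ℝ, ℝ) f (𝒮.embed x₀) :=
    (hfs.contMDiffAt (Φ.open_target.mem_nhds hst)).mdifferentiableAt (by simp)
  have hf0 : ∀ x, (x, (0 : ℝ)) ∈ Φ.source → f (𝒮.embed x) = 0 := by
    intro x hx
    have h1 : 𝒮.embed x = Φ (x, 0) := by rw [← hΦeq hx]; exact (hnE0 x).symm
    show (Φ.toPartialEquiv.symm (𝒮.embed x)).2 = 0
    rw [h1, Φ.toPartialEquiv.left_inv hx]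
  have hfs0 : f (𝒮.embed x₀) = 0 := hf0 x₀ hΦ0
  -- points of `ι(X)` near `(𝒮.embed x₀)` are `ι x` with `(x, 0) ∈ Φ.source`
  obtain ⟨U₁, hU₁o, hU₁⟩ : ∃ U₁ : Set 𝒮.carrier, IsOpen U₁ ∧
      𝒮.embed ⁻¹' U₁ = {x | (x, (0 : ℝ)) ∈ Φ.source} := by
    have hO : IsOpen {x : X | (x, (0 : ℝ)) ∈ Φ.source} :=
      Φ.open_source.preimage (Continuous.prodMk_left 0)
    obtain ⟨U₁, hU₁o, hU₁⟩ := 𝒮.isSmoothEmbedding.isEmbedding.isInducing.isOpen_iff.1 hO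
    exact ⟨U₁, hU₁o, hU₁⟩
  have hsU₁ : (𝒮.embed x₀) ∈ U₁ := by
    have : x₀ ∈ 𝒮.embed ⁻¹' U₁ := by rw [hU₁]; exact hΦ0
    exact this
  /- (3) the differential of `f` at `(𝒮.embed x₀)`: `df_s(u) = -𝒮.metric(ν, u)` -/
  have hkey : ∀ u : TangentSpace (𝓡 (n + 1)) (𝒮.embed x₀),
      mfderiv (𝓡 (n + 1)) 𝓘(ℝ, ℝ) f (𝒮.embed x₀) u = -(𝒮.metric.val (𝒮.embed x₀) (𝒮.normal x₀) u) := by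
    -- `f ∘ Φ = snd` near `(x₀, 0)`, so `df_s ∘ dΦ = snd`
    have hΦd : MDifferentiableAt ((𝓡 n).prod 𝓘(ℝ, ℝ)) (𝓡 (n + 1)) Φ (x₀, 0) :=
      (Φ.contMDiffOn_toFun.contMDiffAt (Φ.open_source.mem_nhds hΦ0)).mdifferentiableAt (by simp)
    have hcomp : mfderiv ((𝓡 n).prod 𝓘(ℝ, ℝ)) 𝓘(ℝ, ℝ) (f ∘ Φ) (x₀, 0) =
        (mfderiv (𝓡 (n + 1)) 𝓘(ℝ, ℝ) f (𝒮.embed x₀)).comp (mfderiv ((𝓡 n).prod 𝓘(ℝ, ℝ)) (𝓡 (n + 1)) Φ (x₀, 0)) := by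
      rw [← hΦs] at hfd
      rw [mfderiv_comp (x₀, 0) hfd hΦd, hΦs]
    have hsnd : mfderiv ((𝓡 n).prod 𝓘(ℝ, ℝ)) 𝓘(ℝ, ℝ) (f ∘ Φ) (x₀, 0) =
        mfderiv ((𝓡 n).prod 𝓘(ℝ, ℝ)) 𝓘(ℝ, ℝ) (Prod.snd : X × ℝ → ℝ) (x₀, 0) := by
      refine Filter.EventuallyEq.mfderiv_eq ?_
      filter_upwards [Φ.open_source.mem_nhds hΦ0] with q hq
      show (Φ.toPartialEquiv.symm (Φ q)).2 = q.2
      rw [Φ.toPartialEquiv.left_inv hq]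
    have hdΦ : ∀ q : TangentSpace ((𝓡 n).prod 𝓘(ℝ, ℝ)) (x₀, (0 : ℝ)),
        mfderiv ((𝓡 n).prod 𝓘(ℝ, ℝ)) (𝓡 (n + 1)) Φ (x₀, 0) q =
          mfderiv (𝓡 n) (𝓡 (n + 1)) 𝒮.embed x₀ q.1 + q.2 • 𝒮.normal x₀ := by
      intro q
      have heq : mfderiv ((𝓡 n).prod 𝓘(ℝ, ℝ)) (𝓡 (n + 1)) Φ (x₀, 0) =
          mfderiv ((𝓡 n).prod 𝓘(ℝ, ℝ)) (𝓡 (n + 1)) nE (x₀, 0) := by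
        refine Filter.EventuallyEq.mfderiv_eq ?_
        filter_upwards [Φ.open_source.mem_nhds hΦ0] with q hq
        exact (hΦeq hq).symm
      rw [heq]
      exact mfderiv_normalExp_zero_apply (cov := cov) (k := (⊤ : ℕ∞)) le_top hνs x₀ q
    have hval : ∀ q : TangentSpace ((𝓡 n).prod 𝓘(ℝ, ℝ)) (x₀, (0 : ℝ)),
        mfderiv (𝓡 (n + 1)) 𝓘(ℝ, ℝ) f (𝒮.embed x₀)
          (mfderiv (𝓡 n) (𝓡 (n + 1)) 𝒮.embed x₀ q.1 + q.2 • 𝒮.normal x₀) = q.2 := by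
      intro q
      have e1 : mfderiv ((𝓡 n).prod 𝓘(ℝ, ℝ)) 𝓘(ℝ, ℝ) (f ∘ Φ) (x₀, 0) q =
          mfderiv (𝓡 (n + 1)) 𝓘(ℝ, ℝ) f (𝒮.embed x₀)
            (mfderiv ((𝓡 n).prod 𝓘(ℝ, ℝ)) (𝓡 (n + 1)) Φ (x₀, 0) q) := by
        rw [hcomp]; rfl
      rw [hdΦ q, hsnd, mfderiv_snd] at e1
      exact e1.symm
    -- every `u` is `dι w + a ν`
    obtain ⟨L, hL⟩ := exists_continuousLinearEquiv_coprod_toSpanSingleton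
      (F := EuclideanSpace ℝ (Fin (n + 1))) (F' := EuclideanSpace ℝ (Fin n))
      (A := mfderiv (𝓡 n) (𝓡 (n + 1)) 𝒮.embed x₀) (v := 𝒮.normal x₀) hιinj hνz hdim
    intro u
    set q : EuclideanSpace ℝ (Fin n) × ℝ := L.symm u with hq
    have hu : u = mfderiv (𝓡 n) (𝓡 (n + 1)) 𝒮.embed x₀ q.1 + q.2 • 𝒮.normal x₀ := by
      have h1 : (L : EuclideanSpace ℝ (Fin n) × ℝ →L[ℝ] EuclideanSpace ℝ (Fin (n + 1))) q = u :=
        L.apply_symm_apply u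
      rw [hL] at h1
      rw [← h1]
      rfl
    rw [hu, hval q, map_add, map_smul, 𝒮.isFutureUnitNormal.1.1 x₀ q.1,
      𝒮.isFutureUnitNormal.1.2 x₀]
    simp
  /- (4) the radial functions `F(r, w) = f(exp_s(r w))` -/
  obtain ⟨S, hSo, hS0, hSdom, hexps⟩ := exists_isOpen_contMDiffOn_expMap_at (cov := cov) (𝒮.embed x₀)
  set ex : EuclideanSpace ℝ (Fin (n + 1)) → 𝒮.carrier :=
    fun v ↦ expMap cov (𝒮.embed x₀) (show TangentSpace (𝓡 (n + 1)) (𝒮.embed x₀) from v) with hex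
  set sm : ℝ × EuclideanSpace ℝ (Fin (n + 1)) → EuclideanSpace ℝ (Fin (n + 1)) :=
    fun p ↦ p.1 • p.2 with hsm
  set A : Set (ℝ × EuclideanSpace ℝ (Fin (n + 1))) :=
    {p | sm p ∈ S ∧ ex (sm p) ∈ Φ.target ∧ ex (sm p) ∈ U₁} with hA
  have hsmc : Continuous sm := continuous_fst.smul continuous_snd
  have hexc : ContinuousOn ex S := hexps.continuousOn
  have hAo : IsOpen A := by
    have h1 : IsOpen (sm ⁻¹' S) := hSo.preimage hsmc
    have h2 : IsOpen ((sm ⁻¹' S) ∩ (ex ∘ sm) ⁻¹' (Φ.target ∩ U₁)) :=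
      (hexc.comp hsmc.continuousOn (fun p hp ↦ hp)).isOpen_inter_preimage h1
        (Φ.open_target.inter hU₁o)
    have heq : A = (sm ⁻¹' S) ∩ (ex ∘ sm) ⁻¹' (Φ.target ∩ U₁) := by
      ext p
      simp only [hA, mem_setOf_eq, mem_inter_iff, mem_preimage, comp_apply]
    rw [heq]; exact h2
  have hex0 : ex 0 = (𝒮.embed x₀) := expMap_zero (cov := cov) (𝒮.embed x₀)
  have hA0 : ∀ w, ((0 : ℝ), w) ∈ A := fun w ↦ by
    have h0 : sm (0, w) = 0 := zero_smul ℝ w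
    have h1 : ex (sm (0, w)) = 𝒮.embed x₀ := by rw [h0, hex0]
    refine ⟨?_, ?_, ?_⟩
    · rw [h0]; exact hS0
    · rw [h1]; exact hst
    · rw [h1]; exact hsU₁
  set F : ℝ × EuclideanSpace ℝ (Fin (n + 1)) → ℝ := fun p ↦ f (ex (sm p)) with hF
  have hFs : ContDiffOn ℝ ∞ F A := by
    rw [← contMDiffOn_iff_contDiffOn]
    have h1 : ContMDiffOn 𝓘(ℝ, ℝ × EuclideanSpace ℝ (Fin (n + 1))) 𝓘(ℝ, EuclideanSpace ℝ (Fin (n + 1)))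
        ∞ sm A := by
      rw [contMDiffOn_iff_contDiffOn]
      exact (contDiff_fst.smul contDiff_snd).contDiffOn
    have h2 : ContMDiffOn 𝓘(ℝ, ℝ × EuclideanSpace ℝ (Fin (n + 1))) (𝓡 (n + 1)) ∞ (ex ∘ sm) A :=
      hexps.comp h1 fun p hp ↦ hp.1
    exact hfs.comp h2 fun p hp ↦ hp.2.1
  have hF0 : ∀ w, F (0, w) = 0 := fun w ↦ by
    show f (ex (sm (0, w))) = 0
    rw [show sm (0, w) = 0 from zero_smul ℝ w, hex0]
    exact hfs0
  -- the `r`-derivative of `F`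
  set F₁ : ℝ × EuclideanSpace ℝ (Fin (n + 1)) → ℝ := fun p ↦ fderiv ℝ F p (1, 0) with hF₁
  have hF₁c : ContinuousOn F₁ A :=
    (hFs.continuousOn_fderiv_of_isOpen hAo (by simp)).clm_apply
      (continuousOn_const (c := ((1 : ℝ), (0 : EuclideanSpace ℝ (Fin (n + 1))))))
  have hFd : ∀ p ∈ A, HasFDerivAt F (fderiv ℝ F p) p := fun p hp ↦
    ((hFs.contDiffAt (hAo.mem_nhds hp)).differentiableAt (by simp)).hasFDerivAt
  -- partial derivative in `r` as a one-variable derivative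
  have hFr : ∀ p ∈ A, HasDerivAt (fun r ↦ F (r, p.2)) (F₁ p) p.1 := by
    rintro ⟨r, w⟩ hp
    have hincl : HasFDerivAt (fun ρ : ℝ ↦ (ρ, w)) (ContinuousLinearMap.inl ℝ ℝ _) r :=
      (hasFDerivAt_id r).prodMk (hasFDerivAt_const w r)
    have h := (hFd (r, w) hp).comp r hincl
    have h' : HasDerivAt (fun ρ : ℝ ↦ F (ρ, w)) ((fderiv ℝ F (r, w)).comp
        (ContinuousLinearMap.inl ℝ ℝ _) 1) r := h.hasDerivAt
    simpa [hF₁] using h'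
  /- (5) at `r = 0`: `F₁(0, w) = df_s(w) = -𝒮.metric(ν, w)` -/
  have hF₁0 : ∀ w : EuclideanSpace ℝ (Fin (n + 1)),
      F₁ (0, w) = -(𝒮.metric.val (𝒮.embed x₀) (𝒮.normal x₀) (show TangentSpace (𝓡 (n + 1)) (𝒮.embed x₀) from w)) := by
    intro w
    -- the curve `r ↦ F(r, w) = (f ∘ ex)(r • w)` has derivative `d(f ∘ ex)_0 (w)` at `0`
    have hexd : MDifferentiableAt 𝓘(ℝ, EuclideanSpace ℝ (Fin (n + 1))) (𝓡 (n + 1)) ex 0 :=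
      (contMDiffAt_expMap_zero (cov := cov) (𝒮.embed x₀)).mdifferentiableAt (by simp)
    have hfd' : MDifferentiableAt (𝓡 (n + 1)) 𝓘(ℝ, ℝ) f (ex 0) := by rw [hex0]; exact hfd
    have hfe : MDifferentiableAt 𝓘(ℝ, EuclideanSpace ℝ (Fin (n + 1))) 𝓘(ℝ, ℝ) (f ∘ ex) 0 :=
      hfd'.comp 0 hexd
    have hfe' : DifferentiableAt ℝ (f ∘ ex) 0 := mdifferentiableAt_iff_differentiableAt.1 hfe
    have hmf : mfderiv 𝓘(ℝ, EuclideanSpace ℝ (Fin (n + 1))) 𝓘(ℝ, ℝ) (f ∘ ex) 0 w =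
        -(𝒮.metric.val (𝒮.embed x₀) (𝒮.normal x₀) (show TangentSpace (𝓡 (n + 1)) (𝒮.embed x₀) from w)) := by
      rw [mfderiv_comp 0 hfd' hexd]
      show mfderiv (𝓡 (n + 1)) 𝓘(ℝ, ℝ) f (ex 0) (mfderiv 𝓘(ℝ, EuclideanSpace ℝ (Fin (n + 1)))
        (𝓡 (n + 1)) ex 0 w) = _
      rw [mfderiv_expMap_zero (cov := cov) (𝒮.embed x₀)]
      show mfderiv (𝓡 (n + 1)) 𝓘(ℝ, ℝ) f (ex 0) (show TangentSpace (𝓡 (n + 1)) (ex 0) from w) = _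
      rw [hex0]
      exact hkey _
    have hfe_fd : fderiv ℝ (f ∘ ex) 0 w =
        -(𝒮.metric.val (𝒮.embed x₀) (𝒮.normal x₀) (show TangentSpace (𝓡 (n + 1)) (𝒮.embed x₀) from w)) := by
      rw [← mfderiv_eq_fderiv]; exact hmf
    -- chain rule with `r ↦ r • w`
    have hline : HasDerivAt (fun r : ℝ ↦ r • w) w 0 := by
      simpa using (hasDerivAt_id (0 : ℝ)).smul_const w
    have hcurve : HasDerivAt ((f ∘ ex) ∘ fun r : ℝ ↦ r • w) (fderiv ℝ (f ∘ ex) 0 w) 0 := by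
      have h0w : (fun r : ℝ ↦ r • w) 0 = 0 := by simp
      have h' : HasFDerivAt (f ∘ ex) (fderiv ℝ (f ∘ ex) 0) ((fun r : ℝ ↦ r • w) 0) := by
        rw [h0w]; exact hfe'.hasFDerivAt
      exact h'.comp_hasDerivAt 0 hline
    have hcurve' : HasDerivAt (fun r : ℝ ↦ F (r, w)) (F₁ (0, w)) 0 := by
      have h := hFr (0, w) (hA0 w)
      exact h
    have huniq := hcurve'.unique hcurve
    rw [huniq, hfe_fd]
  /- (6) uniform negativity on the compact set of unit past causal directions -/
  set K : Set (EuclideanSpace ℝ (Fin (n + 1))) :=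
    {w | ‖w‖ = 1 ∧ 𝒮.metric.val (𝒮.embed x₀) (show TangentSpace (𝓡 (n + 1)) (𝒮.embed x₀) from w)
      (show TangentSpace (𝓡 (n + 1)) (𝒮.embed x₀) from w) ≤ 0 ∧
      𝒮.metric.val (𝒮.embed x₀) (𝒮.timeOrientation.vectorField (𝒮.embed x₀)) (show TangentSpace (𝓡 (n + 1)) (𝒮.embed x₀) from w) ≤ 0} with hK
  have hKc : IsCompact K := by
    have hQ₁ : Continuous fun w : TangentSpace (𝓡 (n + 1)) (𝒮.embed x₀) ↦ 𝒮.metric.val (𝒮.embed x₀) w w :=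
      (𝒮.metric.val (𝒮.embed x₀)).continuous₂.comp (continuous_id.prodMk continuous_id)
    have hQ₂ : Continuous fun w : TangentSpace (𝓡 (n + 1)) (𝒮.embed x₀) ↦ 𝒮.metric.val (𝒮.embed x₀) (𝒮.timeOrientation.vectorField (𝒮.embed x₀)) w :=
      (𝒮.metric.val (𝒮.embed x₀) (𝒮.timeOrientation.vectorField (𝒮.embed x₀))).continuous
    have hcl : IsClosed K := by
      refine (isClosed_eq continuous_norm continuous_const).inter
        ((isClosed_le hQ₁ continuous_const).inter (isClosed_le hQ₂ continuous_const))
    have hsub : K ⊆ Metric.closedBall (0 : EuclideanSpace ℝ (Fin (n + 1))) 1 := fun w hw ↦ by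
      rw [Metric.mem_closedBall, dist_zero_right, hw.1]
    exact (isCompact_closedBall _ _).of_isClosed_subset hcl hsub
  have hKneg : ∀ w ∈ K, 0 < F₁ (0, w) := by
    rintro w ⟨hw1, hwc, hwT⟩
    rw [hF₁0]
    -- `w` is future causal, so `g(ν, w) < 0`
    have hw0 : (show TangentSpace (𝓡 (n + 1)) (𝒮.embed x₀) from w) ≠ 0 := by
      intro h
      have : ‖w‖ = 0 := by rw [show w = 0 from h]; simp
      rw [hw1] at this; exact one_ne_zero this
    have hcausal : 𝒮.metric.IsCausal (show TangentSpace (𝓡 (n + 1)) (𝒮.embed x₀) from w) :=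
      ⟨hwc, hw0⟩
    have hfut : 𝒮.timeOrientation.IsFutureDirected
        (show TangentSpace (𝓡 (n + 1)) (𝒮.embed x₀) from w) := by
      rcases 𝒮.timeOrientation.isFutureDirected_or_isPastDirected_of_isCausal hcausal with h | h
      · exact h
      · exact absurd h.2 (not_lt.2 hwT)
    have hν := 𝒮.isFutureUnitNormal.2 x₀
    have hνt : 𝒮.metric.IsTimelike (𝒮.normal x₀) := by
      rw [LorentzianMetric.isTimelike_iff, 𝒮.isFutureUnitNormal.1.2 x₀]; norm_num
    have h := TimeOrientation.IsFutureDirected.val_lt_zero 𝒮.timeOrientation hν hνt hfut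
    linarith
  -- `F₁ > 0` on `[−r₀, r₀] × K`
  obtain ⟨r₀, hr₀, hr₀A⟩ : ∃ r₀ > 0, ∀ r : ℝ, |r| < r₀ → ∀ w ∈ K, (r, w) ∈ A ∧ 0 < F₁ (r, w) := by
    have hP : ∀ w ∈ K, ∀ᶠ z : ℝ × EuclideanSpace ℝ (Fin (n + 1)) in 𝓝 ((0 : ℝ), w),
        (z.1, z.2) ∈ A ∧ 0 < F₁ (z.1, z.2) := by
      intro w hw
      have hA' : A ∈ 𝓝 ((0 : ℝ), w) := hAo.mem_nhds (hA0 w)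
      have hc : ContinuousAt F₁ (0, w) := hF₁c.continuousAt hA'
      have hlt : ∀ᶠ z in 𝓝 ((0 : ℝ), w), 0 < F₁ z := (continuousAt_const.eventually_lt hc (hKneg w hw))
      filter_upwards [hA', hlt] with z hz hz'
      exact ⟨hz, hz'⟩
    have hev := hKc.eventually_forall_of_forall_eventually
      (P := fun r w ↦ (r, w) ∈ A ∧ 0 < F₁ (r, w)) hP
    obtain ⟨r₀, hr₀, h⟩ := Metric.eventually_nhds_iff.1 hev
    refine ⟨r₀, hr₀, fun r hr w hw ↦ h ?_ w hw⟩
    rw [Real.dist_eq, sub_zero]; exact hr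
  /- (7) `F(r, w) > 0` for `0 < r < r₀`, `w ∈ K` -/
  have hFneg : ∀ w ∈ K, ∀ r, 0 < r → r < r₀ → 0 < F (r, w) := by
    intro w hw r hr hrr
    have hmono : StrictMonoOn (fun ρ ↦ F (ρ, w)) (Icc 0 r) := by
      refine strictMonoOn_of_deriv_pos (convex_Icc 0 r) ?_ ?_
      · intro ρ hρ
        have hρA : (ρ, w) ∈ A := (hr₀A ρ (by rw [abs_lt]; constructor <;> linarith [hρ.1, hρ.2]) w hw).1
        exact (hFr (ρ, w) hρA).continuousAt.continuousWithinAt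
      · intro ρ hρ
        rw [interior_Icc] at hρ
        have h := hr₀A ρ (by rw [abs_lt]; constructor <;> linarith [hρ.1, hρ.2]) w hw
        rw [(hFr (ρ, w) h.1).deriv]
        exact h.2
    have h : F (0, w) < F (r, w) := hmono (left_mem_Icc.2 hr.le) (right_mem_Icc.2 hr.le) hr
    rw [hF0 w] at h
    exact h
  /- (8) conclusion -/
  refine ⟨r₀, hr₀, fun w hw hwr ↦ ?_⟩
  have hw0 : w ≠ 0 := fun h ↦ hw.1.2 h
  set r : ℝ := ‖w‖ with hr
  have hrpos : 0 < r := norm_pos_iff.2 hw0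
  set u : EuclideanSpace ℝ (Fin (n + 1)) := r⁻¹ • w with hu
  have hru : r • u = w := by
    rw [hu, smul_smul, mul_inv_cancel₀ hrpos.ne', one_smul]
  have huK : u ∈ K := by
    refine ⟨by rw [hu, norm_smul, norm_inv, norm_norm, inv_mul_cancel₀ hrpos.ne'], ?_, ?_⟩
    · show 𝒮.metric.val (𝒮.embed x₀) (show TangentSpace (𝓡 (n + 1)) (𝒮.embed x₀) from r⁻¹ • w)
        (show TangentSpace (𝓡 (n + 1)) (𝒮.embed x₀) from r⁻¹ • w) ≤ 0
      have h : 𝒮.metric.val (𝒮.embed x₀) (show TangentSpace (𝓡 (n + 1)) (𝒮.embed x₀) from r⁻¹ • w)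
          (show TangentSpace (𝓡 (n + 1)) (𝒮.embed x₀) from r⁻¹ • w) =
          r⁻¹ * (r⁻¹ * 𝒮.metric.val (𝒮.embed x₀) (show TangentSpace (𝓡 (n + 1)) (𝒮.embed x₀) from w)
            (show TangentSpace (𝓡 (n + 1)) (𝒮.embed x₀) from w)) := by
        show 𝒮.metric.val (𝒮.embed x₀) (r⁻¹ • (show TangentSpace (𝓡 (n + 1)) (𝒮.embed x₀) from w))
          (r⁻¹ • (show TangentSpace (𝓡 (n + 1)) (𝒮.embed x₀) from w)) = _
        rw [map_smul, map_smul]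
        rfl
      rw [h]
      have hi : 0 < r⁻¹ := inv_pos.2 hrpos
      have hc : 𝒮.metric.val (𝒮.embed x₀) (show TangentSpace (𝓡 (n + 1)) (𝒮.embed x₀) from w)
          (show TangentSpace (𝓡 (n + 1)) (𝒮.embed x₀) from w) ≤ 0 := hw.1.1
      nlinarith [mul_pos hi hi]
    · show 𝒮.metric.val (𝒮.embed x₀) (𝒮.timeOrientation.vectorField (𝒮.embed x₀)) (show TangentSpace (𝓡 (n + 1)) (𝒮.embed x₀) from r⁻¹ • w) ≤ 0
      have h : 𝒮.metric.val (𝒮.embed x₀) (𝒮.timeOrientation.vectorField (𝒮.embed x₀)) (show TangentSpace (𝓡 (n + 1)) (𝒮.embed x₀) from r⁻¹ • w) =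
          r⁻¹ * 𝒮.metric.val (𝒮.embed x₀) (𝒮.timeOrientation.vectorField (𝒮.embed x₀)) (show TangentSpace (𝓡 (n + 1)) (𝒮.embed x₀) from w) := by
        show 𝒮.metric.val (𝒮.embed x₀) (𝒮.timeOrientation.vectorField (𝒮.embed x₀)) (r⁻¹ • (show TangentSpace (𝓡 (n + 1)) (𝒮.embed x₀) from w)) = _
        rw [map_smul]
        rfl
      rw [h]
      exact mul_nonpos_iff.2 (Or.inl ⟨(inv_pos.2 hrpos).le, hw.2.le⟩)
  have hA' := (hr₀A r (by rw [abs_of_pos hrpos]; exact hwr) u huK).1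
  have hneg := hFneg u huK r hrpos hwr
  have hsmru : sm (r, u) = w := hru
  refine ⟨?_, ?_⟩
  · have h := hSdom _ hA'.1
    rw [hsmru] at h
    exact h
  · rintro ⟨x, hx⟩
    -- `exp_s w = ι x ∈ U₁`, so `(x, 0) ∈ Φ.source` and `f (ι x) = 0`; but `f (exp_s w) < 0`
    have hwU : ex w ∈ U₁ := by
      have h := hA'.2.2; rwa [hsmru] at h
    have hxU : x ∈ 𝒮.embed ⁻¹' U₁ := by
      show 𝒮.embed x ∈ U₁
      rw [hx]; exact hwU
    rw [hU₁] at hxU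
    have h0 : f (𝒮.embed x) = 0 := hf0 x hxU
    have hFw : F (r, u) = f (ex w) := by
      show f (ex (sm (r, u))) = _
      rw [hsmru]
    have : f (ex w) = 0 := by
      have : ex w = 𝒮.embed x := hx.symm
      rw [this, h0]
    rw [← hFw] at this
    linarith

end DataEmbedding

end Literature.Geometry.Lorentzian

end
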